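import Summits.Ventures.HSemireg.WedgeHankelSiegelIdealPlanes

/-!
# Venture HSemireg — THE SIEGEL IDEAL (6): THE DIAGONAL COEFFICIENT — `coord_{tgt}(x_P y_Q ∧ w_m(q)) = c · q_v` with `c ≠ 0`, by induction
# along th-7's recursion (one pair at a time, four roles), structure constants never evaluated

HONEST FRAMING. Part of the Lean index of the computation cell `pub-hsemireg` (seat p10 gen 11, Sunday typer «UNIFORM-IN-n»).
Finite-dimensional EXTERIOR ALGEBRA over a field ONLY; no variety, no cohomology theory, no sheaf, no Ext group, no semiregularity map;
nothing here says that HC / HC_CM / HC_AV holds; no Literature fact is declared or used.  Custodian versions as in `WedgeHankelSiegelIdeal`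
(1/3); th-7's recursion `w₀(q) = q₀·1`, `w_{m+1}(q) = w_m(q)·x_m + w_m(σq)·y_m` (PART B §N.8) and sign-free coordinate calculus
(`WedgeModelCoord.coord_mul`: the coordinate of a product of block-supported elements at a union of supports is a UNIT structure constant
times the product of the coordinates) are the only tools.  The dictionary is QUOTED, never asserted.

WHY.  To prove the non-vanishing half of the per-block rank law (sequel (7)) one needs ONE explicit non-zero coordinate of `r_{S,b} ∧ w_n(q)`
— a statement th-7's THEOREM H (ranks only) does not give.  THIS FILE (continues namespace `Summit.Ventures.HSemireg.Wedge.HankelSiegelIdeal`;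
imports (5)) isolates that computation:
* §11 a ROLE ASSIGNMENT `ρ : Fin n → ℕ` (role `0`: an `x`-letter of the monomial, `1`: a `y`-letter of the monomial, `2`: a pair where the
  class contributes `y`, `≥ 3`: a pair where the class contributes `x`); below `m`: the monomial `θ_m = x_{ρ=0} ∧ y_{ρ=1}` (`θr`), the target
  support `M_m` (`Mr`: `x` at roles `≠ 2`, `y` at roles `≤ 2`), the index `v_m = #(ρ=0) + #(ρ=2)` (`vr`); four STEP LEMMAS `step0`–`step3`
  (adding the pair `m` in each role: the recursion's two terms, `x_m² = y_m² = 0`, parity commutation `g·w_m(q) = (−1)^m w_m(q)·g`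
  (`gx_mul_w_mul`), and `coord_mul` across the blocks `Dm m ⊔ {x_m, y_m}`), and **`diag`: for every `ρ` and `m ≤ n` there is `c ≠ 0` with
  `coord_{M_m}(θ_m ∧ w_m(q)) = c · q_{v_m}` for EVERY `q`.**
In the quoted dictionary: the coefficient of `∂_{S ∪ (Sᶜ∖T)} ⊗ dz̄_{S ∪ T}` in `(x_{S∖A} y_A) ⌟ v` is `± q_{|S∖A|+|T|}` — the `(a + |T|)`-th
Taylor coefficient of the class, up to a sign that is never needed.  NOT typed: the sign; anything Ext-side.  Class side only.
-/

open Module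

namespace Summit.Ventures.HSemireg.Wedge.HankelSiegelIdeal

open Summit.Ventures.HSemireg.Wedge Summit.Ventures.HSemireg.Wedge.Hankel
  Summit.Ventures.HSemireg.Wedge.HankelSiegel

variable (K : Type*) [Field K] {n : ℕ}

/-! ## §11. The diagonal coefficient: `coord_{tgt(S,T)}(x_{S∖A} y_A ∧ w_n(q)) = c · q_{a+|T|}`, `c ≠ 0` (th-7's recursion, sign-free) -/

section Diagonal

variable (ρ : Fin n → ℕ)

/-- the pairs below `m` with a given role (`0`: `x` in the monomial, `1`: `y` in the monomial, `2`: extra `y` from the class, `≥ 3`: `x` from the class). -/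
def rset (m : ℕ) (j : ℕ) : Finset (Fin n) := Finset.univ.filter fun c => (c : ℕ) < m ∧ ρ c = j

/-- the monomial `x_{role 0} ∧ y_{role 1}` below `m`. -/
noncomputable def θr (m : ℕ) : HT K (In n) := B K (In n) (xs (rset ρ m 0) ∪ ys (rset ρ m 1))

/-- the target monomial below `m`: `x` at the roles `≠ 2`, `y` at the roles `≤ 2`. -/
def Mr (m : ℕ) : Finset (In n) :=
  xs (Finset.univ.filter fun c => (c : ℕ) < m ∧ ρ c ≠ 2) ∪ ys (Finset.univ.filter fun c => (c : ℕ) < m ∧ ρ c ≤ 2)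

/-- the coefficient index: `#(role 0) + #(role 2)` below `m`. -/
def vr (m : ℕ) : ℕ := (rset ρ m 0).card + (rset ρ m 2).card

variable {ρ}

omit [Field K] in
/-- splitting a `< m+1` filter at `m`. -/
lemma filter_lt_succ (pr : Fin n → Prop) [DecidablePred pr] {m : ℕ} (hm : m < n) :
    (Finset.univ.filter fun c : Fin n => (c : ℕ) < m + 1 ∧ pr c) =
      if pr ⟨m, hm⟩ then insert ⟨m, hm⟩ (Finset.univ.filter fun c : Fin n => (c : ℕ) < m ∧ pr c)
      else Finset.univ.filter fun c : Fin n => (c : ℕ) < m ∧ pr c := by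
  ext c
  split_ifs with h
  · simp only [Finset.mem_filter, Finset.mem_univ, true_and, Finset.mem_insert, Fin.ext_iff]
    constructor
    · rintro ⟨h1, h2⟩
      by_cases hc : (c : ℕ) = m
      · exact Or.inl hc
      · exact Or.inr ⟨by omega, h2⟩
    · rintro (hc | ⟨h1, h2⟩)
      · refine ⟨by omega, ?_⟩
        have : c = ⟨m, hm⟩ := Fin.ext hc
        subst this; exact h
      · exact ⟨by omega, h2⟩
  · simp only [Finset.mem_filter, Finset.mem_univ, true_and]
    constructor
    · rintro ⟨h1, h2⟩
      refine ⟨?_, h2⟩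
      by_contra hc
      have : c = ⟨m, hm⟩ := Fin.ext (by simp; omega)
      subst this; exact h h2
    · rintro ⟨h1, h2⟩; exact ⟨by omega, h2⟩

omit [Field K] in
/-- `⟨m⟩` is not below `m`. -/
lemma notMem_filter_lt (pr : Fin n → Prop) [DecidablePred pr] {m : ℕ} (hm : m < n) :
    (⟨m, hm⟩ : Fin n) ∉ (Finset.univ.filter fun c : Fin n => (c : ℕ) < m ∧ pr c) := by
  simp

omit [Field K] in
/-- everything below `m` lies in the first `m` pairs. -/
lemma xs_union_ys_subset_Dm {m : ℕ} {P Q : Finset (Fin n)} (hP : ∀ c ∈ P, (c : ℕ) < m) (hQ : ∀ c ∈ Q, (c : ℕ) < m) :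
    xs P ∪ ys Q ⊆ Dm n m := by
  intro i hi
  simp only [Dm, Finset.mem_filter, Finset.mem_univ, true_and]
  rcases Finset.mem_union.mp hi with h | h
  · obtain ⟨c, hc, rfl⟩ := Finset.mem_map.mp h
    left; simpa using hP c hc
  · obtain ⟨c, hc, rfl⟩ := Finset.mem_map.mp h
    right
    have := hQ c hc
    simp only [Fin.natAddEmb_apply, Fin.val_natAdd]
    omega

omit [Field K] in
/-- a union with a pair is a double insertion (private: a verbatim twin exists under Literature/Probability/Percolation). -/
private lemma union_pair_eq {α : Type*} [DecidableEq α] (M : Finset α) (x y : α) : M ∪ {x, y} = insert x (insert y M) := by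
  rw [Finset.union_insert, Finset.union_comm, ← Finset.insert_eq]

omit [Field K] in
/-- a union with a singleton is an insertion (private, same reason). -/
private lemma union_single_eq {α : Type*} [DecidableEq α] (M : Finset α) (x : α) : M ∪ {x} = insert x M := by
  rw [Finset.union_comm, ← Finset.insert_eq]

/-- a generator anticommutes past th-7's class up to parity: `g · (w_m(q) · z) = (−1)^m · w_m(q) · (g · z)`. -/
lemma gx_mul_w_mul {m : ℕ} (hm : m ≤ n) (i : In n) (q : ℕ → K) (z : HT K (In n)) :
    gx K i * (w K n m q * z) = ((-1 : K) ^ m) • (w K n m q * (gx K i * z)) := by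
  rw [← mul_assoc, gx, B_mul_comm_of_mem_Hom K (w_mem_Hom K hm q), Finset.card_singleton, one_mul, smul_mul_assoc, mul_assoc]

/-- coordinates of single generators at a singleton support. -/
lemma coord_gx_single (i j : In n) : (B K (In n)).coord {j} (gx K i) = if i = j then 1 else 0 := by
  rw [gx, Basis.coord_apply, Basis.repr_self, Finsupp.single_apply]
  simp only [Finset.singleton_inj]

omit [Field K] in
/-- the block of the new pair is disjoint from the first `m` pairs. -/
lemma step_disjoint {m : ℕ} (hmn : m < n) : Disjoint (Dm n m) {Fin.castAdd n ⟨m, hmn⟩, Fin.natAdd n ⟨m, hmn⟩} := by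
  rw [Finset.disjoint_insert_right, Finset.disjoint_singleton_right]; exact ⟨xI_notMem hmn, yI_notMem hmn⟩

/-- the old monomial times the old class lives on the first `m` pairs. -/
lemma step_mem_Alg {m : ℕ} (hmn : m < n) {P Q : Finset (Fin n)} (hP : ∀ c ∈ P, (c : ℕ) < m) (hQ : ∀ c ∈ Q, (c : ℕ) < m)
    (q' : ℕ → K) : B K (In n) (xs P ∪ ys Q) * w K n m q' ∈ Alg K (In n) (Dm n m) :=
  mul_mem_Alg K (B_mem_Alg K (xs_union_ys_subset_Dm hP hQ)) (Hom_le_Alg K _ _ (w_mem_Hom K hmn.le q'))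

section Step

variable {m : ℕ} (hmn : m < n) {P Q : Finset (Fin n)} {M : Finset (In n)}
  (hP : ∀ c ∈ P, (c : ℕ) < m) (hQ : ∀ c ∈ Q, (c : ℕ) < m) (hMD : M ⊆ Dm n m) {c : K} (hc : c ≠ 0) {v : ℕ}
  (hIH : ∀ q : ℕ → K, (B K (In n)).coord M (B K (In n) (xs P ∪ ys Q) * w K n m q) = c * q v)
include hmn hP hQ hMD hc hIH

/-- STEP, role 0: the monomial gains `x_m`, the target gains `x_m, y_m`, the index gains `1`. -/
lemma step0 : ∃ c' : K, c' ≠ 0 ∧ ∀ q : ℕ → K,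
    (B K (In n)).coord (M ∪ {Fin.castAdd n ⟨m, hmn⟩, Fin.natAdd n ⟨m, hmn⟩})
      (B K (In n) (xs (insert ⟨m, hmn⟩ P) ∪ ys Q) * w K n (m + 1) q) = c' * q (v + 1) := by
  have hD := step_disjoint (n := n) hmn
  have hA := step_mem_Alg K hmn hP hQ
  set i : Fin n := ⟨m, hmn⟩ with hi
  have hXm : X K n m = gx K (Fin.castAdd n i) := X_eq_gx K i
  have hYm : Y K n m = gx K (Fin.natAdd n i) := Y_eq_gx K i
  have hne : Fin.castAdd n i ≠ Fin.natAdd n i := castAdd_ne_natAdd i i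
  have nxi : Fin.castAdd n i ∉ xs P ∪ ys Q := by
    rw [Finset.mem_union, not_or, castAdd_mem_xs]; exact ⟨fun h => absurd (hP i h) (lt_irrefl m), castAdd_notMem_ys _ _⟩
  obtain ⟨c₁, hc₁, h₁⟩ := B_mul_gx K (I := In n) (i := Fin.castAdd n i) nxi
  have eθ : B K (In n) (xs (insert i P) ∪ ys Q) = c₁⁻¹ • (B K (In n) (xs P ∪ ys Q) * gx K (Fin.castAdd n i)) := by
    rw [xs_insert, Finset.insert_union, h₁, smul_smul, inv_mul_cancel₀ hc₁, one_smul]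
  have eprod : ∀ q, B K (In n) (xs (insert i P) ∪ ys Q) * w K n (m + 1) q =
      (c₁⁻¹ * (-1) ^ m) • (B K (In n) (xs P ∪ ys Q) * w K n m (shift K q) * (gx K (Fin.castAdd n i) * gx K (Fin.natAdd n i))) := by
    intro q
    rw [eθ, w]
    simp only [hXm, hYm, smul_mul_assoc, mul_add, mul_assoc, gx_mul_w_mul K hmn.le, mul_smul_comm, gx_mul_self, mul_zero,
      smul_zero, zero_add, smul_smul]
  have hw : gx K (Fin.castAdd n i) * gx K (Fin.natAdd n i) ∈ Alg K (In n) {Fin.castAdd n i, Fin.natAdd n i} := by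
    rw [gx_mul_gy]; exact Submodule.smul_mem _ _ (B_mem_Alg K subset_rfl)
  refine ⟨c₁⁻¹ * (-1) ^ m * (u K M {Fin.castAdd n i, Fin.natAdd n i} * u K {Fin.castAdd n i} {Fin.natAdd n i} * c), ?_, fun q => ?_⟩
  · refine mul_ne_zero (mul_ne_zero (inv_ne_zero hc₁) (pow_ne_zero _ (neg_ne_zero.mpr one_ne_zero))) (mul_ne_zero (mul_ne_zero
      ((u_ne_zero_iff K).mpr (Finset.disjoint_of_subset_left hMD hD)) (u_pair_ne_zero K hne)) hc)
  rw [eprod, map_smul, coord_mul K hD (hA _) hw hMD subset_rfl, hIH, gx_mul_gy, map_smul, Basis.coord_apply, Basis.repr_self,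
    Finsupp.single_eq_same, shift_apply, smul_eq_mul, smul_eq_mul, mul_one]
  ring

/-- STEP, role 1: the monomial gains `y_m`, the target gains `x_m, y_m`, the index is unchanged. -/
lemma step1 : ∃ c' : K, c' ≠ 0 ∧ ∀ q : ℕ → K,
    (B K (In n)).coord (M ∪ {Fin.castAdd n ⟨m, hmn⟩, Fin.natAdd n ⟨m, hmn⟩})
      (B K (In n) (xs P ∪ ys (insert ⟨m, hmn⟩ Q)) * w K n (m + 1) q) = c' * q v := by
  have hD := step_disjoint (n := n) hmn
  have hA := step_mem_Alg K hmn hP hQ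
  set i : Fin n := ⟨m, hmn⟩ with hi
  have hXm : X K n m = gx K (Fin.castAdd n i) := X_eq_gx K i
  have hYm : Y K n m = gx K (Fin.natAdd n i) := Y_eq_gx K i
  have hne : Fin.castAdd n i ≠ Fin.natAdd n i := castAdd_ne_natAdd i i
  have nyi : Fin.natAdd n i ∉ xs P ∪ ys Q := by
    rw [Finset.mem_union, not_or, natAdd_mem_ys]; exact ⟨natAdd_notMem_xs _ _, fun h => absurd (hQ i h) (lt_irrefl m)⟩
  obtain ⟨c₁, hc₁, h₁⟩ := B_mul_gx K (I := In n) (i := Fin.natAdd n i) nyi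
  have eθ : B K (In n) (xs P ∪ ys (insert i Q)) = c₁⁻¹ • (B K (In n) (xs P ∪ ys Q) * gx K (Fin.natAdd n i)) := by
    rw [ys_insert, Finset.union_insert, h₁, smul_smul, inv_mul_cancel₀ hc₁, one_smul]
  have eprod : ∀ q, B K (In n) (xs P ∪ ys (insert i Q)) * w K n (m + 1) q =
      (c₁⁻¹ * (-1) ^ m) • (B K (In n) (xs P ∪ ys Q) * w K n m q * (gx K (Fin.natAdd n i) * gx K (Fin.castAdd n i))) := by
    intro q
    rw [eθ, w]
    simp only [hXm, hYm, smul_mul_assoc, mul_add, mul_assoc, gx_mul_w_mul K hmn.le, mul_smul_comm, gx_mul_self, mul_zero,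
      smul_zero, add_zero, smul_smul]
  have hw : gx K (Fin.natAdd n i) * gx K (Fin.castAdd n i) ∈ Alg K (In n) {Fin.castAdd n i, Fin.natAdd n i} := by
    rw [gx_mul_gy, Finset.pair_comm]; exact Submodule.smul_mem _ _ (B_mem_Alg K subset_rfl)
  refine ⟨c₁⁻¹ * (-1) ^ m * (u K M {Fin.castAdd n i, Fin.natAdd n i} * u K {Fin.natAdd n i} {Fin.castAdd n i} * c), ?_, fun q => ?_⟩
  · refine mul_ne_zero (mul_ne_zero (inv_ne_zero hc₁) (pow_ne_zero _ (neg_ne_zero.mpr one_ne_zero))) (mul_ne_zero (mul_ne_zero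
      ((u_ne_zero_iff K).mpr (Finset.disjoint_of_subset_left hMD hD)) (u_pair_ne_zero K hne.symm)) hc)
  rw [eprod, map_smul, coord_mul K hD (hA _) hw hMD subset_rfl, hIH, gx_mul_gy, Finset.pair_comm, map_smul, Basis.coord_apply,
    Basis.repr_self, Finsupp.single_eq_same, smul_eq_mul, smul_eq_mul, mul_one]
  ring

/-- STEP, role 2: the monomial is unchanged, the target gains `y_m`, the index gains `1`. -/
lemma step2 : ∃ c' : K, c' ≠ 0 ∧ ∀ q : ℕ → K,
    (B K (In n)).coord (M ∪ {Fin.natAdd n ⟨m, hmn⟩}) (B K (In n) (xs P ∪ ys Q) * w K n (m + 1) q) = c' * q (v + 1) := by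
  have hD := step_disjoint (n := n) hmn
  have hA := step_mem_Alg K hmn hP hQ
  set i : Fin n := ⟨m, hmn⟩ with hi
  have hXm : X K n m = gx K (Fin.castAdd n i) := X_eq_gx K i
  have hYm : Y K n m = gx K (Fin.natAdd n i) := Y_eq_gx K i
  have hne : Fin.castAdd n i ≠ Fin.natAdd n i := castAdd_ne_natAdd i i
  have hsub : ({Fin.natAdd n i} : Finset (In n)) ⊆ {Fin.castAdd n i, Fin.natAdd n i} := by simp
  refine ⟨u K M {Fin.natAdd n i} * c, mul_ne_zero ((u_ne_zero_iff K).mpr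
    (Finset.disjoint_of_subset_left hMD (Finset.disjoint_of_subset_right hsub hD))) hc, fun q => ?_⟩
  rw [w, hXm, hYm, mul_add, ← mul_assoc, ← mul_assoc, map_add,
    coord_mul K hD (hA _) (B_mem_Alg K (by simp)) hMD hsub, coord_mul K hD (hA _) (B_mem_Alg K (by simp)) hMD hsub,
    hIH, hIH, coord_gx_single, coord_gx_single, if_neg hne, if_pos rfl, shift_apply]
  ring

/-- STEP, role 3: the monomial is unchanged, the target gains `x_m`, the index is unchanged. -/
lemma step3 : ∃ c' : K, c' ≠ 0 ∧ ∀ q : ℕ → K,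
    (B K (In n)).coord (M ∪ {Fin.castAdd n ⟨m, hmn⟩}) (B K (In n) (xs P ∪ ys Q) * w K n (m + 1) q) = c' * q v := by
  have hD := step_disjoint (n := n) hmn
  have hA := step_mem_Alg K hmn hP hQ
  set i : Fin n := ⟨m, hmn⟩ with hi
  have hXm : X K n m = gx K (Fin.castAdd n i) := X_eq_gx K i
  have hYm : Y K n m = gx K (Fin.natAdd n i) := Y_eq_gx K i
  have hne : Fin.castAdd n i ≠ Fin.natAdd n i := castAdd_ne_natAdd i i
  have hsub : ({Fin.castAdd n i} : Finset (In n)) ⊆ {Fin.castAdd n i, Fin.natAdd n i} := by simp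
  refine ⟨u K M {Fin.castAdd n i} * c, mul_ne_zero ((u_ne_zero_iff K).mpr
    (Finset.disjoint_of_subset_left hMD (Finset.disjoint_of_subset_right hsub hD))) hc, fun q => ?_⟩
  rw [w, hXm, hYm, mul_add, ← mul_assoc, ← mul_assoc, map_add,
    coord_mul K hD (hA _) (B_mem_Alg K (by simp)) hMD hsub, coord_mul K hD (hA _) (B_mem_Alg K (by simp)) hMD hsub,
    hIH, hIH, coord_gx_single, coord_gx_single, if_pos rfl, if_neg hne.symm]
  ring

end Step

/-- **THE DIAGONAL COEFFICIENT (inductive form).** For every role assignment and every `m ≤ n` there is a unit `c` with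
`coord_{M_m}(θ_m ∧ w_m(q)) = c · q_{v_m}` for EVERY `q` (induction along th-7's recursion; structure constants never evaluated). -/
theorem diag {m : ℕ} (hm : m ≤ n) :
    ∃ c : K, c ≠ 0 ∧ ∀ q : ℕ → K, (B K (In n)).coord (Mr ρ m) (θr K ρ m * w K n m q) = c * q (vr ρ m) := by
  induction m with
  | zero =>
    refine ⟨1, one_ne_zero, fun q => ?_⟩
    have h0 : ∀ j, rset ρ 0 j = ∅ := fun j => by ext c; simp [rset]
    have hM : Mr ρ 0 = ∅ := by ext c; simp [Mr, xs, ys]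
    simp only [θr, vr, h0, hM, xs, ys, Finset.map_empty, Finset.union_empty, Finset.card_empty, add_zero, w, mul_smul_comm,
      mul_one, map_smul, smul_eq_mul, one_mul]
    rw [Basis.coord_apply, Basis.repr_self, Finsupp.single_eq_same, mul_one]
  | succ m ih =>
    obtain ⟨c, hc, hcq⟩ := ih (by omega)
    have hmn : m < n := by omega
    set i : Fin n := ⟨m, hmn⟩ with hi
    have hP : ∀ c ∈ rset ρ m 0, (c : ℕ) < m := fun c hc => (Finset.mem_filter.mp hc).2.1
    have hQ : ∀ c ∈ rset ρ m 1, (c : ℕ) < m := fun c hc => (Finset.mem_filter.mp hc).2.1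
    have hMD : Mr ρ m ⊆ Dm n m :=
      xs_union_ys_subset_Dm (fun c hc => (Finset.mem_filter.mp hc).2.1) (fun c hc => (Finset.mem_filter.mp hc).2.1)
    have hr : ∀ j : ℕ, rset ρ (m + 1) j = if ρ i = j then insert i (rset ρ m j) else rset ρ m j := fun j => by
      rw [rset, filter_lt_succ (fun c => ρ c = j) hmn]; rfl
    have hMx : (Finset.univ.filter fun c : Fin n => (c : ℕ) < m + 1 ∧ ρ c ≠ 2) =
        if ρ i ≠ 2 then insert i (Finset.univ.filter fun c : Fin n => (c : ℕ) < m ∧ ρ c ≠ 2)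
        else Finset.univ.filter fun c : Fin n => (c : ℕ) < m ∧ ρ c ≠ 2 := filter_lt_succ (fun c => ρ c ≠ 2) hmn
    have hMy : (Finset.univ.filter fun c : Fin n => (c : ℕ) < m + 1 ∧ ρ c ≤ 2) =
        if ρ i ≤ 2 then insert i (Finset.univ.filter fun c : Fin n => (c : ℕ) < m ∧ ρ c ≤ 2)
        else Finset.univ.filter fun c : Fin n => (c : ℕ) < m ∧ ρ c ≤ 2 := filter_lt_succ (fun c => ρ c ≤ 2) hmn
    have nT : i ∉ rset ρ m 2 := notMem_filter_lt _ hmn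
    by_cases h0 : ρ i = 0
    · obtain ⟨c', hc', h'⟩ := step0 K hmn hP hQ hMD hc hcq
      refine ⟨c', hc', fun q => ?_⟩
      have e1 : θr K ρ (m + 1) = B K (In n) (xs (insert i (rset ρ m 0)) ∪ ys (rset ρ m 1)) := by
        rw [θr, hr, hr, if_pos h0, if_neg (by omega)]
      have e2 : Mr ρ (m + 1) = Mr ρ m ∪ {Fin.castAdd n i, Fin.natAdd n i} := by
        rw [Mr, hMx, hMy, if_pos (by omega), if_pos (by omega), xs_insert, ys_insert, Finset.insert_union, Finset.union_insert,
          ← Mr, union_pair_eq]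
      have nP : i ∉ rset ρ m 0 := notMem_filter_lt _ hmn
      have e3 : vr ρ (m + 1) = vr ρ m + 1 := by
        rw [vr, vr, hr, hr, if_pos h0, if_neg (by omega), Finset.card_insert_of_notMem nP]; omega
      rw [e1, e2, e3, h']
    by_cases h1 : ρ i = 1
    · obtain ⟨c', hc', h'⟩ := step1 K hmn hP hQ hMD hc hcq
      refine ⟨c', hc', fun q => ?_⟩
      have e1 : θr K ρ (m + 1) = B K (In n) (xs (rset ρ m 0) ∪ ys (insert i (rset ρ m 1))) := by
        rw [θr, hr, hr, if_neg h0, if_pos h1]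
      have e2 : Mr ρ (m + 1) = Mr ρ m ∪ {Fin.castAdd n i, Fin.natAdd n i} := by
        rw [Mr, hMx, hMy, if_pos (by omega), if_pos (by omega), xs_insert, ys_insert, Finset.insert_union, Finset.union_insert,
          ← Mr, union_pair_eq]
      have e3 : vr ρ (m + 1) = vr ρ m := by
        rw [vr, vr, hr, hr, if_neg h0, if_neg (by omega)]
      rw [e1, e2, e3, h']
    by_cases h2 : ρ i = 2
    · obtain ⟨c', hc', h'⟩ := step2 K hmn hP hQ hMD hc hcq
      refine ⟨c', hc', fun q => ?_⟩
      have e1 : θr K ρ (m + 1) = θr K ρ m := by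
        rw [θr, θr, hr, hr, if_neg h0, if_neg h1]
      have e2 : Mr ρ (m + 1) = Mr ρ m ∪ {Fin.natAdd n i} := by
        rw [Mr, hMx, hMy, if_neg (by omega), if_pos (by omega), ys_insert, Finset.union_insert, ← Mr, union_single_eq]
      have e3 : vr ρ (m + 1) = vr ρ m + 1 := by
        rw [vr, vr, hr, hr, if_neg h0, if_pos h2, Finset.card_insert_of_notMem nT]; omega
      rw [e1, e2, e3, θr, h']
    · obtain ⟨c', hc', h'⟩ := step3 K hmn hP hQ hMD hc hcq
      refine ⟨c', hc', fun q => ?_⟩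
      have e1 : θr K ρ (m + 1) = θr K ρ m := by
        rw [θr, θr, hr, hr, if_neg h0, if_neg h1]
      have e2 : Mr ρ (m + 1) = Mr ρ m ∪ {Fin.castAdd n i} := by
        rw [Mr, hMx, hMy, if_pos (by omega), if_neg (by omega), xs_insert, Finset.insert_union, ← Mr, union_single_eq]
      have e3 : vr ρ (m + 1) = vr ρ m := by
        rw [vr, vr, hr, hr, if_neg h0, if_neg h2]
      rw [e1, e2, e3, θr, h']

end Diagonal


end Summit.Ventures.HSemireg.Wedge.HankelSiegelIdeal
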